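import Summits.HodgeConjecture.HodgeConjecture.Theorems.PadicSemiregularLiftHodgeDeRhamDegeneration
import Literature.AlgebraicGeometry.Crystalline.HodgeDeRhamDegenerationProofs
import HarnessLib

/-!
# Route `PadicSemiregularLift`, support item `HodgeDeRhamDegeneration` (stmt-HodgeConjecture-15974):
# reduction to the heart range

The route declaration `Theses.PadicSemiregularLift.HodgeDeRhamDegeneration` is verbatim the Literature
named fact `Literature.AlgebraicGeometry.Crystalline.HodgeDeRhamDegeneratesModTorsion` (Deligne 1968,
Thm. 5.5 (ii); bridge `hodgeDeRhamDegeneration_iff_degeneratesModTorsion` in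
`Theorems/PadicSemiregularLiftHodgeDeRhamDegeneration`). The Literature file
`Crystalline/HodgeDeRhamDegenerationProofs` proves the fact outside its heart (columns `n₁ ≤ 0`,
`n₁ > d`, degrees `k₁ < n₁`: the connecting homomorphism is zero there) and reduces it to the HEART
range `0 < n₁ ≤ d`, `n₁ ≤ k₁` (`hodgeDeRhamDegeneratesModTorsion_of_heart`). This file transports that
reduction to the route item: `hodgeDeRhamDegeneration_of_heart` — the item follows from Deligne's
theorem in the heart range alone, stated with exactly the binders of the item plus the three range
hypotheses. It is the precise residual obligation of stmt-HodgeConjecture-15974; nothing of Deligne's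
theorem (char-`0` Hodge theory, or Deligne–Illusie with spreading out, plus flat base change
`W → W[1/p]`) is proved here, and no statement is weakened or restated.
-/

-- `Summit.HodgeConjecture.HodgeConjecture.Theorems` is the mandated namespace (single-conjunct summit:
-- Sub = Summit), which `linter.dupNamespace` flags on every declaration; the lakefile turns the
-- linter off tree-wide (weak option), restated here so stand-alone elaboration is warning-free too.
set_option linter.dupNamespace false

-- As in `Crystalline/HodgeDeRhamDegeneration`: `HasHyperExt` for the truncations in the expanded binder of
-- `heart` is found through `IsStrictlyGE 0 ⇒ IsGE 0` and the shift/localization instances; the default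
-- instance-synthesis budget is too small for the STATEMENT (no proof search is affected).
set_option synthInstance.maxHeartbeats 200000

noncomputable section

namespace Summit.HodgeConjecture.HodgeConjecture.Theorems

open CategoryTheory AlgebraicGeometry TopologicalSpace
open Literature.AlgebraicGeometry.Motives Literature.AlgebraicGeometry.Motives.WittScheme
open Literature.Algebra.Homology Literature.AlgebraicGeometry.Crystalline

/-- **The route item `HodgeDeRhamDegeneration` follows from the heart range of Deligne's theorem.**
If, for every smooth proper model `𝒳/W(k)` of relative dimension `d` and all `n₀ + 1 = n₁`,
`k₀ + 1 = k₁` with `0 < n₁ ≤ d` and `n₁ ≤ k₁`, the connecting homomorphism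
`δ : ℍ^{k₀}(𝒳, σ≤n₀ Ω•) → ℍ^{k₁}(𝒳, Ωⁿ¹[-n₁]) = H^{k₁-n₁}(𝒳, Ωⁿ¹)` of the stupid filtration of the
algebraic de Rham complex has torsion values (Deligne 1968, Thm. 5.5 (ii), for the columns
`Ω¹, …, Ωᵈ` in non-negative degree — the part with no carrier in the tree), then the item holds:
outside that range `δ = 0` (`Crystalline.hodgeDeRhamDegeneratesModTorsion_trivialRange`), and the item
is the named fact `Crystalline.HodgeDeRhamDegeneratesModTorsion` on the nose. An implication from an
explicit hypothesis; unconditional only in the trivial range. [cite: Deligne1968, Thm. 5.5 (ii)] -/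
theorem hodgeDeRhamDegeneration_of_heart
    (heart : ∀ (p : ℕ) [Fact p.Prime] (k : Type) [Field k] [CharP k p] (d : ℕ)
      (𝒳 : SchemeOver (WittVector p k)), IsSmoothProperModel d 𝒳 →
      ∀ (n₀ n₁ : ℤ) (h : n₀ + 1 = n₁) (k₀ k₁ : ℤ) (hk : k₀ + 1 = k₁),
        0 < n₁ → n₁ ≤ (d : ℤ) → n₁ ≤ k₁ →
      letI K : CochainComplex (Sheaf (Opens.grothendieckTopology 𝒳.left.carrier)
          AddCommGrpCat.{0}) ℤ :=
        (algebraicDeRhamComplex 𝒳).extend ComplexShape.embeddingUpNat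
      letI Z : Sheaf (Opens.grothendieckTopology 𝒳.left.carrier) AddCommGrpCat.{0} :=
        (constantSheaf (Opens.grothendieckTopology 𝒳.left.carrier) AddCommGrpCat.{0}).obj
          (AddCommGrpCat.of (ULift.{0} ℤ))
      letI S : ShortComplex (CochainComplex (Sheaf (Opens.grothendieckTopology 𝒳.left.carrier)
          AddCommGrpCat.{0}) ℤ) := stupidFiltrationShortComplex K n₀ n₁ h
      haveI : (S.X₁).IsStrictlyGE n₁ :=
        (inferInstance : ((CochainComplex.singleFunctor _ n₁).obj (K.X n₁)).IsStrictlyGE n₁)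
      haveI : HasHyperExt.{0} Z S.X₁ := hasHyperExt_of_isGE _ _ n₁
      haveI : HasHyperExt.{0} Z S.X₂ := (inferInstance : HasHyperExt.{0} Z (stupidTruncLE K n₁))
      haveI : HasHyperExt.{0} Z S.X₃ := (inferInstance : HasHyperExt.{0} Z (stupidTruncLE K n₀))
      ∀ x : HyperExt.{0} Z S.X₃ k₀,
        ∃ m : ℤ, m ≠ 0 ∧
          m • HyperExt.delta (shortExact_stupidFiltrationShortComplex K n₀ n₁ h) k₀ k₁ hk x = 0) :
    Theses.PadicSemiregularLift.HodgeDeRhamDegeneration :=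
  hodgeDeRhamDegeneration_of_degeneratesModTorsion (hodgeDeRhamDegeneratesModTorsion_of_heart heart)

end Summit.HodgeConjecture.HodgeConjecture.Theorems

end
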